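import Literature.IUT.HodgeArakelov.EtaleThetaDataOfSettingAutActionKummerGalois
import Literature.IUT.HodgeArakelov.EtaleThetaDataOfSettingAutActionKummer

/-!
# [IUTchII] Prop 3.4 (i), binder (P3) at the GENUINE constant-monoid Kummer map: `ρ_α` carries `Ψ_cns = κ(O)` onto
# itself for EVERY `α ∈ Aut_top(Π^tp_X̲̲)`, from (HGAL) ∧ (HCYC) — assembly

Proof-only assembly (abc-iut cell, D-0067 wave 4, seat abc-iut-w4-d007 gen 7; layer L6; GAP-LEDGER row **G-w5d169-3**,
binder (P3) `hκ` / `hequiv` of node IUTchII:Prop3.4(i)) of this seat's `EtaleThetaDataOfSettingAutActionKummerGalois.lean`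
(«hsemi» at `A = ℚ̄_pˣ` from a Galois element `τ_α` with (HGAL) `ε ∘ α = Inn(τ_α) ∘ ε` and (HCYC) naturality of the
level-`M` cyclotomic rigidity identifications) with abc-iut-w5-d169's `EtaleThetaDataOfSettingAutActionKummer.lean`
(p433365: `exists_equivariant_h1LimKummerOn_of_semilinear`, `map_mrange_h1LimKummerOn_eq_of_semilinear` from «hsemi»)
and this lineage's `EtaleThetaDataOfSettingKummerTower.lean` (p422741: the tower coefficients
`exists_cyclotomeCoefficients_of_cyclotomeTower`).  No definitions; nothing restated.

S. Mochizuki, *Inter-universal Teichmüller theory II*, kurims manuscript (Dec. 2020), Prop. 3.4 (i) p. 91 ("the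
left-hand square in each diagram arises from the functoriality of the algorithms involved"), Prop. 3.1 (ii) p. 88,
Cor. 1.11 p. 49 [cite: Mochizuki2012, Prop 3.4 (i) p.91]; *Topics in absolute anabelian geometry III*, Cor. 1.10 p. 46,
Prop. 3.2 p. 71.  Claim key `Mochizuki2012` (D-0012, DISPUTED); nothing here takes a side on [IUTchIII] Cor. 3.12.

PROVED, at `Π = Π^tp_X̲̲` with the constants `ℚ̄_pˣ ⊇ O` through `ε` (`unitsAction`), for ANY `G_{ℚ_p}`-stable submonoid
`O` and the tower coefficients `c` (`red_M (c ζ) = ζ_M`), from `hgal : ∀ α ∃ τ, (HGAL) ∧ (HCYC)`: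
* `exists_equivariant_h1LimKummerOn_of_galois` — `hequiv`: `κ = h1LimKummerOn c O` intertwines `ρ_α` with an
  automorphism of `O`, for every `α`;
* `map_mrange_h1LimKummerOn_eq_of_galois` — (P3) `hκ`: `ρ_α (κ(O)) = κ(O)` for every `α`;
* **`exists_coeff_map_mrange_h1LimKummerOn_eq_of_galois`** — the same with `c` no longer free: under the origin guard
  and compactness of `Δ_Θ` THERE IS a bijective change of coefficient cyclotome `c`, inverse to the model's
  identifications `mods`, for which (P3) holds for every `α` (companion of this lineage's
  `prop31ii_thetaEnvRecordKummer_of_cyclotomeTower`, same `c`).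
Residual named inputs of (P3) at the genuine Kummer map: (HGAL) [AbsTopIII] Cor. 1.10 and (HCYC) [IUTchII] Cor. 1.11 (b)
/ [EtTh] Cor. 2.19 (i), both THEOREMS on `Inn(Π^tp_X̲̲)` (`hgal_of_inner`).  Typed ≠ proved for outer `α`.
-/

noncomputable section

open Topology

namespace Literature.IUT.HodgeArakelov

namespace EtaleThetaDataOfSetting

open Literature.AnabelianGeometry.EtaleTheta Literature.AnabelianGeometry.SemiGraphs CohomologySystemOfContH1

variable {p : ℕ} [Fact p.Prime] {D : Literature.AnabelianGeometry.EtaleTheta.ThetaSetting p}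
  {E : D.EtaleThetaData} {l : ℕ} (C : E.DoubleUnderline l)
  (hq : IsQuotientMap D.toTheta) {N : ℕ+} (μ : D.CyclotomeMod l N) {Es : Set ℕ+}
  (τw : D.CyclotomeTower l Es) (c : CyclotomeCoefficients (phi C) (D.lDeltaTheta l) (PadicAlgCl p)ˣ)
  (hlev : ∀ (ζ : cyclotome (PadicAlgCl p)ˣ) (M : ℕ+),
    (((τw.modAll M).red (c.hom ζ) : MuN p M) : (PadicAlgCl p)ˣ) = (ζ : ℕ+ → (PadicAlgCl p)ˣ) M)
  (O : Submonoid (PadicAlgCl p)ˣ)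
  (hO : ∀ (σ : GQp p) (u : (PadicAlgCl p)ˣ), u ∈ O → Units.map (σ : PadicAlgCl p →* PadicAlgCl p) u ∈ O)

include hlev hO in
/-- **`hequiv` at the genuine constant-monoid Kummer map from (HGAL) ∧ (HCYC)**: for every `α ∈ Aut_top(Π^tp_X̲̲)`,
`κ = h1LimKummerOn c O : O → lim_J H¹(Π^tp_Ÿ̲̲ ∩ J, l·Δ_Θ)` intertwines `ρ_α` with SOME automorphism of `O` — the
hypothesis `hequiv` of abc-iut-w5-d169's `EtaleLevels.prop34i_multiradiallyDefined_ofRootHypEquiv` at this `κ`.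
[cite: Mochizuki2012, Prop 3.4 (i) p.91] -/
theorem exists_equivariant_h1LimKummerOn_of_galois (hC : D.Compat) (hS : D.Sec2Hyps) (h15 : D.Prop15iii E hC)
    (L : C.CuspLabels) (R : RigidData.{0} N l) (hR : R = C.rigidData μ hC hS h15 L) (h218i : R.Cor218_i)
    (hO' : D.IsEtThOrigin)
    (hgal : ∀ α : (Pi C) ≃ₜ* (Pi C), ∃ τ : GQp p,
      (∀ x : Pi C, aug C (α x) = τ * aug C x * τ⁻¹) ∧
      (∀ (M : ℕ+) (z w : D.lDeltaTheta l),
        ((rangeAutOfCor218i C μ hq hC hS h15 L R hR h218i α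
            ⟨(z : D.GtpTheta), lDeltaTheta_le_phiRange C z.2⟩ : phiRange C) : D.GtpTheta) = (w : D.GtpTheta) →
          (τw.modAll M).red w = galMuN p M τ ((τw.modAll M).red z)))
    (α : (Pi C) ≃ₜ* (Pi C)) :
    ∃ e' : O ≃* O, ∀ m : O,
      AddEquiv.toMultiplicative (autActOfCor218i C hq μ hC hS h15 L R hR h218i α)
          (h1LimKummerOn (phi C) (D.lDeltaTheta l) (PiYdd C) c (isOpen_stabilizer_units C)
            (finiteIndex_stabilizer_units C) O m) =
        h1LimKummerOn (phi C) (D.lDeltaTheta l) (PiYdd C) c (isOpen_stabilizer_units C)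
          (finiteIndex_stabilizer_units C) O (e' m) :=
  exists_equivariant_h1LimKummerOn_of_semilinear C hq c (isOpen_stabilizer_units C)
    (finiteIndex_stabilizer_units C) μ hC hS h15 L R hR h218i O
    (hsemi_units_of_galois C hq μ τw c hlev O hO hC hS h15 L R hR h218i hO' hgal) α

include hlev hO in
/-- **Binder (P3) `hκ` at the genuine constant-monoid Kummer map from (HGAL) ∧ (HCYC)**: `ρ_α` carries
`Ψ_cns = κ(O)` onto itself for every `α ∈ Aut_top(Π^tp_X̲̲)`. [cite: Mochizuki2012, Prop 3.4 (i) p.91] -/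
theorem map_mrange_h1LimKummerOn_eq_of_galois (hC : D.Compat) (hS : D.Sec2Hyps) (h15 : D.Prop15iii E hC)
    (L : C.CuspLabels) (R : RigidData.{0} N l) (hR : R = C.rigidData μ hC hS h15 L) (h218i : R.Cor218_i)
    (hO' : D.IsEtThOrigin)
    (hgal : ∀ α : (Pi C) ≃ₜ* (Pi C), ∃ τ : GQp p,
      (∀ x : Pi C, aug C (α x) = τ * aug C x * τ⁻¹) ∧
      (∀ (M : ℕ+) (z w : D.lDeltaTheta l),
        ((rangeAutOfCor218i C μ hq hC hS h15 L R hR h218i α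
            ⟨(z : D.GtpTheta), lDeltaTheta_le_phiRange C z.2⟩ : phiRange C) : D.GtpTheta) = (w : D.GtpTheta) →
          (τw.modAll M).red w = galMuN p M τ ((τw.modAll M).red z)))
    (α : (Pi C) ≃ₜ* (Pi C)) :
    (MonoidHom.mrange (h1LimKummerOn (phi C) (D.lDeltaTheta l) (PiYdd C) c (isOpen_stabilizer_units C)
        (finiteIndex_stabilizer_units C) O)).map
        (AddEquiv.toMultiplicative (autActOfCor218i C hq μ hC hS h15 L R hR h218i α) :
          Multiplicative (h1Lim (phi C) (D.lDeltaTheta l) (PiYdd C) ⊥) →*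
            Multiplicative (h1Lim (phi C) (D.lDeltaTheta l) (PiYdd C) ⊥)) =
      MonoidHom.mrange (h1LimKummerOn (phi C) (D.lDeltaTheta l) (PiYdd C) c (isOpen_stabilizer_units C)
        (finiteIndex_stabilizer_units C) O) :=
  map_mrange_h1LimKummerOn_eq_of_semilinear C hq c (isOpen_stabilizer_units C)
    (finiteIndex_stabilizer_units C) μ hC hS h15 L R hR h218i O
    (hsemi_units_of_galois C hq μ τw c hlev O hO hC hS h15 L R hR h218i hO' hgal) α

omit c hlev in
include hO in
/-- **(P3) with the coefficient datum DISCHARGED**: under the origin guard and compactness of `Δ_Θ` there is a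
bijective change of coefficient cyclotome `c : Λ(ℚ̄_pˣ) ⥲ l·Δ_Θ`, inverse to the tower's identifications
(`red_M (c ζ) = ζ_M`), such that for the genuine Kummer map `κ = h1LimKummerOn c O` of the `G_{ℚ_p}`-stable constant
monoid `O`, `ρ_α (κ(O)) = κ(O)` for EVERY `α ∈ Aut_top(Π^tp_X̲̲)` — given `hgal` ((HGAL) ∧ (HCYC) for every `α`).
Same `c` as this lineage's `prop31ii_thetaEnvRecordKummer_of_cyclotomeTower` (Prop. 3.1 (ii) at the genuine record).
[cite: Mochizuki2012, Prop 3.4 (i) p.91] -/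
theorem exists_coeff_map_mrange_h1LimKummerOn_eq_of_galois (hC : D.Compat) (hS : D.Sec2Hyps)
    (h15 : D.Prop15iii E hC) (L : C.CuspLabels) (R : RigidData.{0} N l) (hR : R = C.rigidData μ hC hS h15 L)
    (h218i : R.Cor218_i) (hO' : D.IsEtThOrigin) (hΔ : IsCompact (D.DeltaTheta : Set D.GtpTheta))
    (hgal : ∀ α : (Pi C) ≃ₜ* (Pi C), ∃ τ : GQp p,
      (∀ x : Pi C, aug C (α x) = τ * aug C x * τ⁻¹) ∧
      (∀ (M : ℕ+) (z w : D.lDeltaTheta l),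
        ((rangeAutOfCor218i C μ hq hC hS h15 L R hR h218i α
            ⟨(z : D.GtpTheta), lDeltaTheta_le_phiRange C z.2⟩ : phiRange C) : D.GtpTheta) = (w : D.GtpTheta) →
          (τw.modAll M).red w = galMuN p M τ ((τw.modAll M).red z))) :
    ∃ c : CyclotomeCoefficients (phi C) (D.lDeltaTheta l) (PadicAlgCl p)ˣ,
      Function.Bijective c.hom ∧
      (∀ (ζ : cyclotome (PadicAlgCl p)ˣ) (M : ℕ+),
        (((τw.modAll M).red (c.hom ζ) : MuN p M) : (PadicAlgCl p)ˣ) = (ζ : ℕ+ → (PadicAlgCl p)ˣ) M) ∧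
      ∀ α : (Pi C) ≃ₜ* (Pi C),
        (MonoidHom.mrange (h1LimKummerOn (phi C) (D.lDeltaTheta l) (PiYdd C) c (isOpen_stabilizer_units C)
            (finiteIndex_stabilizer_units C) O)).map
            (AddEquiv.toMultiplicative (autActOfCor218i C hq μ hC hS h15 L R hR h218i α) :
              Multiplicative (h1Lim (phi C) (D.lDeltaTheta l) (PiYdd C) ⊥) →*
                Multiplicative (h1Lim (phi C) (D.lDeltaTheta l) (PiYdd C) ⊥)) =
          MonoidHom.mrange (h1LimKummerOn (phi C) (D.lDeltaTheta l) (PiYdd C) c (isOpen_stabilizer_units C)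
            (finiteIndex_stabilizer_units C) O) := by
  obtain ⟨c, hc, hlev⟩ := exists_cyclotomeCoefficients_of_cyclotomeTower C hO' hΔ τw
  exact ⟨c, hc, hlev, fun α =>
    map_mrange_h1LimKummerOn_eq_of_galois C hq μ τw c hlev O hO hC hS h15 L R hR h218i hO' hgal α⟩

end EtaleThetaDataOfSetting

end Literature.IUT.HodgeArakelov

end
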